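import Mathlib

/-!
# T5Assembly — the Tier-5 assembly «N1 ∧ N2 ∧ N3 ∧ N4 ∧ N5 ⟹ (N_D) ⟹ (N)» as a named-Prop skeleton

Kernel annex of seat p7, written on p5's request (STATUS 2026-08-25T01:42:44Z) for sub-step N0 of
the cell pub-hodge-repro2 (route/T5-N0-p5.md (N0.4) ASSEMBLY and (N0.P4); route/T5-LEAN-p7.md).

The five sub-step statements enter as OPAQUE data in exactly the logical shape (N0.4) uses them;
nothing about S, the f_i, the Schwartz data, the theta lifts or the pairing is asserted:

* `Datum` — the type of data D of (N0.3) (the (K, (μ_i, ε_i, χ_i)_i, q_i, p_i, ν, …) of (N0.1)(b));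
  `AdmDatum` — «D is an admissible instance of (N0.1)(b)» (N2, route-3);
* `Choice` — the type of choices (φ_i, q_i, p_i) of Lemma A7.3(b) / B7(b); `AdmChoice D c` — «c is
  admissible for D»;
* `I σ D c` — the period ∫_S f_1^*e_{1,σ} ∧ ⋯ ∧ f_4^*e_{4,σ} of (N0.2) at the embedding σ, for D and c;
  `P D c` — the automorphic pairing ⟨F_A, F_B⟩ of N1 at the base embedding τ₁;
* `iA, iB` — hypothesis (i) of Proposition N* for π₀ and for π₀′ (= N4 = (R1) ∧ (R2) ∧ (R3));
  `iiA, iiB` — hypothesis (ii) for the two tori (= N5 = (R4)); `ellA, ellB` — «ℓ_A^σ ≢ 0 on σ^τ»,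
  «ℓ_B^σ ≢ 0 on σ^τ».

`AssemblyCore` records N1 (period ↔ pairing, with the explicit non-zero constant absorbed:
`P D c ≠ 0 → I τ₁ D c ≠ 0` at every admissible choice), N2 (admissibility of D) and N3 (Proposition
N*, sides A and B, and its Hecke-isolation step producing an admissible choice with non-zero
pairing). The theorems then take N4 and N5 as hypotheses:

* `ND_of_N4_N5` — N1 ∧ N2 ∧ N3 ∧ N4 ∧ N5 ⟹ (N_D): `∃ c, AdmChoice D c ∧ I τ₁ D c ≠ 0`;
* `N_of_N4_N5` — ⟹ (N): `∃ σ D c, AdmDatum D ∧ AdmChoice D c ∧ I σ D c ≠ 0` ((N0.2)(q1));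
* `ND_modulo`, `N_modulo` — the residual bookkeeping of (N0.P4): if N4 and N5 are only known
  modulo a residual `G` (a [G] of the GAPS collector), (N_D) and (N) hold modulo the same `G`;
* `N1_of_const` — the N1 field from the explicit form `I τ₁ D c = κ c * P D c`, `κ c ≠ 0`
  (Theorem ID(iv) with its constant).
-/

namespace Summit.Ventures.HodgeRepro2.T5Assembly

/-- The Tier-5 assembly data of (N0.4): the objects and the three sub-step statements N1, N2, N3
in the shape (N0.P4) uses them. `S` = the set Σ of embeddings, `Datum` = the data D of (N0.3),
`Choice` = the admissible choices (φ_i, q_i, p_i), `K` = the field of values of the period. -/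
structure AssemblyCore (S Datum Choice K : Type*) [Zero K] where
  /-- «D is an admissible instance of (N0.1)(b)» (the content of N2). -/
  AdmDatum : Datum → Prop
  /-- «the choice c is admissible for the datum D» (B7(b), Lemma A7.3(b)). -/
  AdmChoice : Datum → Choice → Prop
  /-- the period I_σ(D, c) = ∫_S f_1^*e_{1,σ} ∧ ⋯ ∧ f_4^*e_{4,σ} of (N0.2). -/
  I : S → Datum → Choice → K
  /-- the automorphic pairing ⟨F_A, F_B⟩ of N1 (at the base embedding). -/
  P : Datum → Choice → K
  /-- the base embedding τ₁ ((N0.2)(q1)). -/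
  τ₁ : S
  /-- the datum D of (N0.3). -/
  D : Datum
  /-- hypothesis (i) of Proposition N* for π₀ (side A). -/
  iA : Prop
  /-- hypothesis (i) of Proposition N* for π₀′ (side B). -/
  iB : Prop
  /-- hypothesis (ii) of Proposition N* for the torus T_A (side A). -/
  iiA : Prop
  /-- hypothesis (ii) of Proposition N* for the torus T_B (side B). -/
  iiB : Prop
  /-- «ℓ_A^σ ≢ 0 on σ^τ». -/
  ellA : Prop
  /-- «ℓ_B^σ ≢ 0 on σ^τ». -/
  ellB : Prop
  /-- N1 (p2): at every admissible choice, a non-zero pairing gives a non-zero period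
  (I = c · P with c ≠ 0, Theorem ID(iv)). -/
  N1 : ∀ c, AdmChoice D c → P D c ≠ 0 → I τ₁ D c ≠ 0
  /-- N2 (route-3): the datum D is admissible. -/
  N2 : AdmDatum D
  /-- N3 (Proposition N*, side A): (i_A) ∧ (ii_A) ⟹ ℓ_A^σ ≢ 0 on σ^τ. -/
  N3A : iA → iiA → ellA
  /-- N3 (Proposition N*, side B): (i_B) ∧ (ii_B) ⟹ ℓ_B^σ ≢ 0 on σ^τ. -/
  N3B : iB → iiB → ellB
  /-- N3's Hecke-isolation step (MEMO §9.3(c), route-3 §9 Δ0): both sides non-zero ⟹ some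
  admissible choice has ⟨F_A, F_B⟩ ≠ 0. -/
  N3iso : ellA → ellB → ∃ c, AdmChoice D c ∧ P D c ≠ 0

variable {S Datum Choice K : Type*} [Zero K]

/-- The statement (N_D) of (N0.2) for the assembly data `A`: the period at τ₁ is non-zero for the
datum D and some admissible choice. -/
def ND (A : AssemblyCore S Datum Choice K) : Prop :=
  ∃ c, A.AdmChoice A.D c ∧ A.I A.τ₁ A.D c ≠ 0

/-- The statement (N) of (N0.2) for the assembly data `A`: some embedding σ, some admissible datum
and some admissible choice have a non-zero period. -/
def N (A : AssemblyCore S Datum Choice K) : Prop :=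
  ∃ σ D c, A.AdmDatum D ∧ A.AdmChoice D c ∧ A.I σ D c ≠ 0

/-- (N0.4)/(N0.P4), the assembly: N1 ∧ N2 ∧ N3 (the fields of `A`) ∧ N4 (= (i_A) ∧ (i_B)) ∧ N5
(= (ii_A) ∧ (ii_B)) ⟹ (N_D). -/
theorem ND_of_N4_N5 (A : AssemblyCore S Datum Choice K) (hN4 : A.iA ∧ A.iB)
    (hN5 : A.iiA ∧ A.iiB) : ND A := by
  obtain ⟨c, hc, hP⟩ := A.N3iso (A.N3A hN4.1 hN5.1) (A.N3B hN4.2 hN5.2)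
  exact ⟨c, hc, A.N1 c hc hP⟩

/-- (N0.2)(q1): (N_D) ⟹ (N), the witnesses being σ = τ₁, the datum D (admissible by N2) and
the choice found. -/
theorem N_of_ND (A : AssemblyCore S Datum Choice K) (h : ND A) : N A := by
  obtain ⟨c, hc, hI⟩ := h
  exact ⟨A.τ₁, A.D, c, A.N2, hc, hI⟩

/-- The full chain: N1 ∧ N2 ∧ N3 ∧ N4 ∧ N5 ⟹ (N). -/
theorem N_of_N4_N5 (A : AssemblyCore S Datum Choice K) (hN4 : A.iA ∧ A.iB)
    (hN5 : A.iiA ∧ A.iiB) : N A :=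
  N_of_ND A (ND_of_N4_N5 A hN4 hN5)

/-- Residual bookkeeping of (N0.P4): if N4 and N5 are known only modulo a residual `G` (the
conjunction of the [G] rows of the GAPS collector), then (N_D) holds modulo the same `G`. -/
theorem ND_modulo (A : AssemblyCore S Datum Choice K) (G : Prop) (hN4 : G → A.iA ∧ A.iB)
    (hN5 : G → A.iiA ∧ A.iiB) : G → ND A :=
  fun hG => ND_of_N4_N5 A (hN4 hG) (hN5 hG)

/-- The same for (N): every residual of N4/N5 is a residual of (N), and nothing else is added. -/
theorem N_modulo (A : AssemblyCore S Datum Choice K) (G : Prop) (hN4 : G → A.iA ∧ A.iB)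
    (hN5 : G → A.iiA ∧ A.iiB) : G → N A :=
  fun hG => N_of_N4_N5 A (hN4 hG) (hN5 hG)

/-- (N_D) unfolded: the definition `ND` is literally the existential statement of (N0.2) — «the
period at τ₁ is non-zero for the datum D and some admissible choice c» — nothing more. -/
theorem ND_iff (A : AssemblyCore S Datum Choice K) :
    ND A ↔ ∃ c, A.AdmChoice A.D c ∧ A.I A.τ₁ A.D c ≠ 0 :=
  Iff.rfl

/-- The N1 field from its explicit form (Theorem ID(iv)): I_{τ₁}(D, c) = κ(c) · P(D, c) with
κ(c) ≠ 0 at every admissible choice. -/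
theorem N1_of_const {K : Type*} [Field K] (AdmChoice : Datum → Choice → Prop)
    (I : S → Datum → Choice → K) (P : Datum → Choice → K) (τ₁ : S) (D : Datum) (κ : Choice → K)
    (hκ : ∀ c, AdmChoice D c → κ c ≠ 0) (hI : ∀ c, AdmChoice D c → I τ₁ D c = κ c * P D c) :
    ∀ c, AdmChoice D c → P D c ≠ 0 → I τ₁ D c ≠ 0 := by
  intro c hc hP
  rw [hI c hc]
  exact mul_ne_zero (hκ c hc) hP

end Summit.Ventures.HodgeRepro2.T5Assembly
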